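import Summits.QuantumFields.BalabanUV.Beta.AxialDressingRootedBmDress
import Literature.MathematicalPhysics.QuantumFieldTheory.Balaban1983to89.Beta.BalabanCompositeJets

/-!
# `BalabanUV.Beta.D1BFx.PairPackDressing` — road «BF-x» for binder row D1, slot (K): **THE Πᵀ_bm-DRESSING OF BOTH BOND INDICES OF A PAIR PACK
# PRESERVES `LocStencil₂`** — the pair-pack twin of an2's `AxialDressingRooted.locStencil_coProjBmAtK` (first-order packs), i.e. the localisation
# letter of the OWNER's fully dressed pair family `S₂^{ΠΠ} κ u κ′ u′ := Πᵀ_bm^{outer} (κ₀ u₀ ↦ Πᵀ_bm (S₂ κ₀ u₀) κ′ u′) κ u` of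
# `PackedDressingBridge.vertex2OfK_coDressKBmAt_eq_full` (`vertex2OfK (coDressKBmAt ρ N K) N S₂ = vertex2OfK K N S₂^{ΠΠ}`)

HONEST DEPENDENCY (cell records, verbatim): «continuum YM on T⁴ ⇐ BetaPertH ∧ nine spine estimates (0/9 proved); BetaPertH ⇐ (D1) ∧ (D4) ∧
CAP+tail; G-an2-4 gates asym, D1 and NE2/3/4.»  HONEST FRAMING (cell contract, verbatim): «discharging `BetaPertH` makes Bałaban's UV stability
UNCONDITIONAL — a real constructive-QFT result; it is NOT the continuum limit and NOT the Clay problem.»  THIS MODULE DISCHARGES NOTHING of (K),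
of D1 or of the wall: [folklore] finite-window bookkeeping — an2's window bound `abs_coProjBmAt_le` (`|Πᵀ_bm g| ≤ cWb·sup_window |g|`), the window
radius `l1_le_of_mem_cube`, and the `ℓ¹` triangle inequality; no definition, no `def … : Prop`, nothing cited, 0 sorry.  0 root-level binders of row D1
discharged (hW ∕ hR-sockets ∕ hSX-socket ∕ D1Tel ∕ D1Rep — 0); (K) NOT closed; NOT D1, NOT `BetaPertH`, NOT continuum, NOT Clay.

ABSOLUTE RULE (cell charter, verbatim): «No internally-minted statement may enter as a cited fact. Every hypothesis is either kernel-proved in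
this package or a verbatim quotation of a PUBLISHED theorem with page reference. The manuscript(s) under audit are NOT citable for their own
disputed steps — they are the thing under adjudication; programme-internal (2001/route/tribunal) claims are never citable.»

WHY.  The (K6c) assembly reads the road's second-order tables through the OWNER's PACK-BRIDGE §5 as `vertex2OfK K N S₂^{ΠΠ}`; the table rows of
`RestTableBlockMass` (`mass_blk_vertex2OfK_le` ∕ `_NlegRoad_le`, generic in the pair pack) and leaf-01's `RestKernelSandwichLoc` §1 (BODY → mass letters)
want a localisation letter OF `S₂^{ΠΠ}`.  This file supplies it from the literal's `LocStencil₂ S₂ C₂ δ₂`: same rate, constant `cKb'·(cKb'·C₂)`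
(`cKb' d N δ = cWb d N·e^{2δ(d+1)N}`, an2's bond-slot dressing constant).

CONTENT (all [folklore]; `ρ := toSite r`, `r ∈ box (d+1) N`, `1 ≤ N`, `0 ≤ δ`):
* §1 **`locStencil₂_coProjBmAtK_inner`**: dressing the SECOND bond index, `LocStencil₂ (κ u κ′ u′ ↦ Πᵀ_bm (S₂ κ u) κ′ u′) (cWb·e^{δ(d+1)N}·C₂) δ`
  (one re-centring: `|u′ + v − u|₁ ≥ |u′ − u|₁ − |v|₁`, `|v|₁ ≤ (d+1)N` on the window).
* §2 **`locStencil₂_coProjBmAtK_outer`**: dressing the FIRST bond index of any `LocStencil₂` two-bond family `T`,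
  `LocStencil₂ (κ u κ′ u′ ↦ Πᵀ_bm (κ₀ u₀ ↦ T κ₀ u₀ κ′ u′) κ u) (cWb·e^{3δ(d+1)N}·C) δ` (three re-centrings: the base point moves by `v`).
* §3 **`locStencil₂_coProjBmAtK₂`**: both, in the OWNER's spelling — `LocStencil₂ S₂^{ΠΠ} (cKb' d N δ·(cKb' d N δ·C₂)) δ`.
Unit `b2b-balaban-beta-d1-formalise-leaf-04` (gen 19), D1 formalisation swarm leaf prover 04, road «BF-x»; INTENT «PAIR-PACK DRESSING» (journal).
-/

noncomputable section

open Finset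
open scoped BigOperators
open Literature.MathematicalPhysics.QuantumFieldTheory.Balaban1983to89
open Literature.MathematicalPhysics.QuantumFieldTheory.Balaban1983to89.Beta
open B12Sec2to5 (l1 l1_nonneg)
open ExpKernelCalculus (MKer BiLoc l1_sub_triangle l1_sub_symm)
open AffineAveraging (box toSite)
open OneStepResolventKernel (Fib)
open BalabanCompositeJets (LocStencil₂)
open Summit.QuantumFields.BalabanUV.Beta.AxialDressingRooted (cube l1_le_of_mem_cube coProjBmAt coProjBmAtK coProjBmAtK_eval cWb cWb_nonneg cKb'
  abs_coProjBmAt_le)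

namespace Summit.QuantumFields.BalabanUV.Beta.D1BFx.PairPackDressing

variable {d N : ℕ} (hN : 1 ≤ N) {r : Fin (d + 1) → ℕ} (hr : r ∈ box (d + 1) N)
include hN hr

/-! ## §1 Dressing the second bond index -/

/-- [folklore] **Πᵀ_bm ON THE SECOND BOND INDEX PRESERVES `LocStencil₂`**: for a pair pack `S₂` with `LocStencil₂ S₂ C₂ δ` (`0 ≤ δ`), the family
`κ u κ′ u′ ↦ Πᵀ_bm (S₂ κ u) κ′ u′` is `LocStencil₂` at the same rate with constant `cWb d N·e^{δ(d+1)N}·C₂` — the window average reads `S₂ κ u κ₁ (u′+v)`,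
`|v|₁ ≤ (d+1)N`, and `|u′+v−u|₁ ≥ |u′−u|₁ − |v|₁` costs one factor `e^{δ(d+1)N}`; the kernel arguments are not moved. -/
theorem locStencil₂_coProjBmAtK_inner {S₂ : Fin (d + 1) → (Fin (d + 1) → ℤ) → Fin (d + 1) → (Fin (d + 1) → ℤ) → MKer (d + 1) (Fib d)}
    {C₂ δ : ℝ} (hS₂ : LocStencil₂ S₂ C₂ δ) (hδ : 0 ≤ δ) :
    LocStencil₂ (fun κ u κ' u' => coProjBmAtK (toSite r) N (S₂ κ u) κ' u') (cWb d N * Real.exp (δ * (((d : ℝ) + 1) * N)) * C₂) δ := by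
  have hC : 0 ≤ C₂ := hS₂.nonneg
  intro κ u κ' u' x z a b
  show |coProjBmAtK (toSite r) N (S₂ κ u) κ' u' x z a b| ≤ _
  rw [coProjBmAtK_eval]
  have hM : ∀ (κ₁ : Fin (d + 1)) (v : Fin (d + 1) → ℤ), v ∈ cube (d + 1) N →
      |S₂ κ u κ₁ (u' + v) x z a b| ≤ C₂ * Real.exp (δ * (((d : ℝ) + 1) * N)) * Real.exp (-δ * l1 (u' - u))
        * Real.exp (-δ * (l1 (x - u) + l1 (z - u))) := by
    intro κ₁ v hv
    have hv' : l1 v ≤ ((d : ℝ) + 1) * N := by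
      have h := l1_le_of_mem_cube hv
      push_cast at h
      exact h
    -- `|u' − u|₁ ≤ |u' + v − u|₁ + |v|₁`
    have ht : l1 (u' - u) ≤ l1 (u' + v - u) + l1 v := by
      have h1 := l1_sub_triangle u' (u' + v) u
      have e : l1 (u' - (u' + v)) = l1 v := by rw [l1_sub_symm, add_sub_cancel_left]
      linarith [e ▸ h1]
    have key : δ * l1 (u' - u) ≤ δ * l1 (u' + v - u) + δ * (((d : ℝ) + 1) * N) := by
      have h2 : l1 (u' - u) ≤ l1 (u' + v - u) + ((d : ℝ) + 1) * N := ht.trans (by linarith)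
      have := mul_le_mul_of_nonneg_left h2 hδ
      linarith [this]
    have h1 : Real.exp (-δ * l1 (u' + v - u)) ≤ Real.exp (δ * (((d : ℝ) + 1) * N)) * Real.exp (-δ * l1 (u' - u)) := by
      rw [← Real.exp_add]
      exact Real.exp_le_exp.2 (by linarith)
    calc |S₂ κ u κ₁ (u' + v) x z a b| ≤ C₂ * Real.exp (-δ * l1 (u' + v - u)) * Real.exp (-δ * (l1 (x - u) + l1 (z - u))) :=
          hS₂ κ u κ₁ (u' + v) x z a b
      _ ≤ C₂ * (Real.exp (δ * (((d : ℝ) + 1) * N)) * Real.exp (-δ * l1 (u' - u))) * Real.exp (-δ * (l1 (x - u) + l1 (z - u))) :=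
          mul_le_mul_of_nonneg_right (mul_le_mul_of_nonneg_left h1 hC) (Real.exp_pos _).le
      _ = _ := by ring
  calc |coProjBmAt (toSite r) N (fun κ₁ u₁ => S₂ κ u κ₁ u₁ x z a b) κ' u'|
      ≤ cWb d N * (C₂ * Real.exp (δ * (((d : ℝ) + 1) * N)) * Real.exp (-δ * l1 (u' - u))
          * Real.exp (-δ * (l1 (x - u) + l1 (z - u)))) := abs_coProjBmAt_le hN hr _ κ' u' hM
    _ = cWb d N * Real.exp (δ * (((d : ℝ) + 1) * N)) * C₂ * Real.exp (-δ * l1 (u' - u))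
          * Real.exp (-δ * (l1 (x - u) + l1 (z - u))) := by ring

/-! ## §2 Dressing the first bond index -/

/-- [folklore] **Πᵀ_bm ON THE FIRST BOND INDEX PRESERVES `LocStencil₂`**: for any two-bond family `T` with `LocStencil₂ T C δ` (`0 ≤ δ`), the family
`κ u κ′ u′ ↦ Πᵀ_bm (κ₀ u₀ ↦ T κ₀ u₀ κ′ u′) κ u` is `LocStencil₂` at the same rate with constant `cWb d N·e^{3δ(d+1)N}·C` — the window average reads
`T β (u+v) κ′ u′`, localised at the MOVED base point `u + v`; re-centring the three weights `|u′−·|₁`, `|x−·|₁`, `|z−·|₁` from `u+v` to `u` costs `e^{3δ|v|₁} ≤ e^{3δ(d+1)N}`. -/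
theorem locStencil₂_coProjBmAtK_outer {T : Fin (d + 1) → (Fin (d + 1) → ℤ) → Fin (d + 1) → (Fin (d + 1) → ℤ) → MKer (d + 1) (Fib d)}
    {C δ : ℝ} (hT : LocStencil₂ T C δ) (hδ : 0 ≤ δ) :
    LocStencil₂ (fun κ u κ' u' => coProjBmAtK (toSite r) N (fun κ₀ u₀ => T κ₀ u₀ κ' u') κ u)
      (cWb d N * Real.exp (3 * (δ * (((d : ℝ) + 1) * N))) * C) δ := by
  have hC : 0 ≤ C := hT.nonneg
  intro κ u κ' u' x z a b
  show |coProjBmAtK (toSite r) N (fun κ₀ u₀ => T κ₀ u₀ κ' u') κ u x z a b| ≤ _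
  rw [coProjBmAtK_eval]
  have hM : ∀ (β : Fin (d + 1)) (v : Fin (d + 1) → ℤ), v ∈ cube (d + 1) N →
      |T β (u + v) κ' u' x z a b| ≤ C * Real.exp (3 * (δ * (((d : ℝ) + 1) * N))) * Real.exp (-δ * l1 (u' - u))
        * Real.exp (-δ * (l1 (x - u) + l1 (z - u))) := by
    intro β v hv
    have hv' : l1 v ≤ ((d : ℝ) + 1) * N := by
      have h := l1_le_of_mem_cube hv
      push_cast at h
      exact h
    have ev : l1 ((u + v) - u) = l1 v := by rw [add_sub_cancel_left]
    have t1 : l1 (u' - u) ≤ l1 (u' - (u + v)) + l1 v := by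
      have h := l1_sub_triangle u' (u + v) u
      rwa [ev] at h
    have t2 : l1 (x - u) ≤ l1 (x - (u + v)) + l1 v := by
      have h := l1_sub_triangle x (u + v) u
      rwa [ev] at h
    have t3 : l1 (z - u) ≤ l1 (z - (u + v)) + l1 v := by
      have h := l1_sub_triangle z (u + v) u
      rwa [ev] at h
    have key : δ * (l1 (u' - u) + l1 (x - u) + l1 (z - u))
        ≤ δ * (l1 (u' - (u + v)) + l1 (x - (u + v)) + l1 (z - (u + v))) + 3 * (δ * (((d : ℝ) + 1) * N)) := by
      have := mul_le_mul_of_nonneg_left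
        (add_le_add (add_le_add t1 t2) t3 : l1 (u' - u) + l1 (x - u) + l1 (z - u)
          ≤ (l1 (u' - (u + v)) + l1 v) + (l1 (x - (u + v)) + l1 v) + (l1 (z - (u + v)) + l1 v)) hδ
      have hδv := mul_le_mul_of_nonneg_left hv' hδ
      nlinarith [this, hδv]
    have h1 : Real.exp (-δ * l1 (u' - (u + v))) * Real.exp (-δ * (l1 (x - (u + v)) + l1 (z - (u + v))))
        ≤ Real.exp (3 * (δ * (((d : ℝ) + 1) * N))) * Real.exp (-δ * l1 (u' - u)) * Real.exp (-δ * (l1 (x - u) + l1 (z - u))) := by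
      rw [← Real.exp_add, ← Real.exp_add, ← Real.exp_add]
      exact Real.exp_le_exp.2 (by linarith)
    calc |T β (u + v) κ' u' x z a b|
        ≤ C * Real.exp (-δ * l1 (u' - (u + v))) * Real.exp (-δ * (l1 (x - (u + v)) + l1 (z - (u + v)))) := hT β (u + v) κ' u' x z a b
      _ = C * (Real.exp (-δ * l1 (u' - (u + v))) * Real.exp (-δ * (l1 (x - (u + v)) + l1 (z - (u + v))))) := by ring
      _ ≤ C * (Real.exp (3 * (δ * (((d : ℝ) + 1) * N))) * Real.exp (-δ * l1 (u' - u)) * Real.exp (-δ * (l1 (x - u) + l1 (z - u)))) :=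
          mul_le_mul_of_nonneg_left h1 hC
      _ = _ := by ring
  calc |coProjBmAt (toSite r) N (fun κ₀ u₀ => T κ₀ u₀ κ' u' x z a b) κ u|
      ≤ cWb d N * (C * Real.exp (3 * (δ * (((d : ℝ) + 1) * N))) * Real.exp (-δ * l1 (u' - u))
          * Real.exp (-δ * (l1 (x - u) + l1 (z - u)))) := abs_coProjBmAt_le hN hr _ κ u hM
    _ = cWb d N * Real.exp (3 * (δ * (((d : ℝ) + 1) * N))) * C * Real.exp (-δ * l1 (u' - u))
          * Real.exp (-δ * (l1 (x - u) + l1 (z - u))) := by ring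

/-! ## §3 Both indices: the OWNER's `S₂^{ΠΠ}` -/

/-- [folklore] **THE FULLY Πᵀ_bm-DRESSED PAIR PACK IS `LocStencil₂`**: for `LocStencil₂ S₂ C₂ δ` (`0 ≤ δ`),
`LocStencil₂ (κ u κ′ u′ ↦ Πᵀ_bm (κ₀ u₀ ↦ Πᵀ_bm (S₂ κ₀ u₀) κ′ u′) κ u) (cKb' d N δ·(cKb' d N δ·C₂)) δ` — §2 after §1, with
`cWb·e^{3δ(d+1)N}·(cWb·e^{δ(d+1)N}·C₂) = cKb'·(cKb'·C₂)`, `cKb' d N δ = cWb d N·e^{2δ(d+1)N}`.  This is the pair family of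
`PackedDressingBridge.vertex2OfK_coDressKBmAt_eq_full` VERBATIM; the table rows of `RestTableBlockMass` and the BODY letters of `RestKernelSandwichLoc` read it. -/
theorem locStencil₂_coProjBmAtK₂ {S₂ : Fin (d + 1) → (Fin (d + 1) → ℤ) → Fin (d + 1) → (Fin (d + 1) → ℤ) → MKer (d + 1) (Fib d)}
    {C₂ δ : ℝ} (hS₂ : LocStencil₂ S₂ C₂ δ) (hδ : 0 ≤ δ) :
    LocStencil₂ (fun κ u κ' u' => coProjBmAtK (toSite r) N (fun κ₀ u₀ => coProjBmAtK (toSite r) N (S₂ κ₀ u₀) κ' u') κ u)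
      (cKb' d N δ * (cKb' d N δ * C₂)) δ := by
  have h := locStencil₂_coProjBmAtK_outer hN hr (locStencil₂_coProjBmAtK_inner hN hr hS₂ hδ) hδ
  have e : cWb d N * Real.exp (3 * (δ * (((d : ℝ) + 1) * N))) * (cWb d N * Real.exp (δ * (((d : ℝ) + 1) * N)) * C₂)
      = cKb' d N δ * (cKb' d N δ * C₂) := by
    have hexp : Real.exp (3 * (δ * (((d : ℝ) + 1) * N))) * Real.exp (δ * (((d : ℝ) + 1) * N))
        = Real.exp (2 * δ * (((d : ℝ) + 1) * N)) * Real.exp (2 * δ * (((d : ℝ) + 1) * N)) := by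
      rw [← Real.exp_add, ← Real.exp_add]
      congr 1
      ring
    calc cWb d N * Real.exp (3 * (δ * (((d : ℝ) + 1) * N))) * (cWb d N * Real.exp (δ * (((d : ℝ) + 1) * N)) * C₂)
        = cWb d N * cWb d N * (Real.exp (3 * (δ * (((d : ℝ) + 1) * N))) * Real.exp (δ * (((d : ℝ) + 1) * N))) * C₂ := by ring
      _ = cWb d N * cWb d N * (Real.exp (2 * δ * (((d : ℝ) + 1) * N)) * Real.exp (2 * δ * (((d : ℝ) + 1) * N))) * C₂ := by rw [hexp]
      _ = cKb' d N δ * (cKb' d N δ * C₂) := by simp only [cKb']; ring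
  rw [← e]
  exact h

/-! ## §4 The σ-currency: dress AFTER weakening the rate (v1.1) -/

/-- [folklore] **PAIR-PACK DRESSING IN THE σ-CURRENCY**: weaken the pair pack's rate to any `0 ≤ σ ≤ δ` FIRST (`LocStencil₂.mono`), then dress both bond indices:
`LocStencil₂ S₂^{ΠΠ} (cKb' d N σ·(cKb' d N σ·C₂)) σ`.  At `σ ≲ 1∕N` the constant is POLYNOMIAL in `N` (`cKb'_le_of_rate_mul_le`), at an `N`-free rate it is
exponential in `N` — the dressing cost located by leaf-01 g23 (R1): a kernel localised at scale `1∕δ` averaged over a window of side `N` is localised at scale `N`. -/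
theorem locStencil₂_coProjBmAtK₂_of_rate {S₂ : Fin (d + 1) → (Fin (d + 1) → ℤ) → Fin (d + 1) → (Fin (d + 1) → ℤ) → MKer (d + 1) (Fib d)}
    {C₂ δ σ : ℝ} (hS₂ : LocStencil₂ S₂ C₂ δ) (hσ0 : 0 ≤ σ) (hσ : σ ≤ δ) :
    LocStencil₂ (fun κ u κ' u' => coProjBmAtK (toSite r) N (fun κ₀ u₀ => coProjBmAtK (toSite r) N (S₂ κ₀ u₀) κ' u') κ u)
      (cKb' d N σ * (cKb' d N σ * C₂)) σ :=
  locStencil₂_coProjBmAtK₂ hN hr (hS₂.mono hσ) hσ0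

omit hN hr in
/-- [folklore] **THE DRESSING CONSTANT AT A RATE `σ ≤ c∕N` IS POLYNOMIAL IN `N`**: `σ·N ≤ c ⟹ cKb' d N σ ≤ cWb d N·e^{2c(d+1)}`
(`cWb d N = (2N+1)^{d+1}·(d+1)·(1+4(d+1)N)`). -/
theorem cKb'_le_of_rate_mul_le {σ c : ℝ} (hσN : σ * N ≤ c) : cKb' d N σ ≤ cWb d N * Real.exp (2 * c * ((d : ℝ) + 1)) := by
  simp only [cKb']
  refine mul_le_mul_of_nonneg_left (Real.exp_le_exp.2 ?_) (cWb_nonneg d N)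
  have hd : (0 : ℝ) ≤ (d : ℝ) + 1 := by positivity
  nlinarith [mul_le_mul_of_nonneg_left hσN hd]

end Summit.QuantumFields.BalabanUV.Beta.D1BFx.PairPackDressing

end
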